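import Literature.NumberTheory.Transcendental.PhilipponCriterionSetup
import HarnessLib

/-!
# Philippon's criterion over Nesterenko's toolkit, XII: inequalities for the induction step — proofs only

`Literature/NumberTheory/Transcendental/PhilipponCriterionStepBounds.lean` — proofs only (no new
definitions, nothing asserted). The elementary estimates used in the induction step of Philippon's
proof of Théorème 2.11 (Publ. Math. IHÉS 64 (1986), §3, proof of Lemme 2.14, pp. 44–45: "On déduit
des hypothèses du théorème (2.11) que, si `C` est assez grand en fonction de `c₁, c₃` et `n`, …"),
for the standing data `𝒮 : Setup` (`PhilipponCriterionSetup.lean`):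

* `size_le_of_bounds` — under the conditions `(i)_N` of `(A_r)`, `size_N(𝔓) ≤ (B_r + D₀) τ(N) δ(N)^{r₀−r}`,
  hence `(1 + 11m²) size_N(𝔓) ≤ S(N)/2` for `C ≥ 2(1+11m²)(B_r + D₀)` (`cS_mul_size_le_half_S`);
* `bezout_exponent_le`, `bezout_exponent_le'` — the positive terms of Prop. 4.11 3) and Cor. 4.12 3)
  for a generator `E` of level `M ≤ N` (degree `≤ δ(M)`, height `≤ σ(M)`) are
  `≤ (1 + 11m²) size_N(𝔓)`, resp. `≤ (1 + 12m²) size_N(𝔓)`;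
* `eta_pos`, `eta_le`, `le_eta` — the integer `η = ⌈4 ξ(M)⌉` of Cor. 4.12 (`0 < η`, `4ξ(M) ≤ η ≤ 5ξ(N)`);
* `normAt_pow_eta_le_sq` — the hypothesis `‖E‖^η ≤ ρ²` of Cor. 4.12 in the case `M < N` from
  `‖E‖ ≤ e^{−S(M)}`, `κ e^{−R(M+1)} ≤ ρ`, `R(M+1) ≤ S(M) ξ(M)` and `log(4Θ²) ≤ C ≤ S(M)` (p. 45:
  "`η = S(M)/2R(M+1)` … `S(M)/R(M+1) ≥ …`"); `normAt_le_exp_deg` — `‖E‖ ≤ e^{−2m dE}` for `C ≥ 2m`;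
* `one_le_d` — a non-zero generator has degree `≥ 1` (a non-zero constant `c` has `‖c‖_ω̄ = 1`,
  not `≤ e^{−S(M)} < 1`): the hypothesis `1 ≤ d` of Cor. 4.12 / Prop. 4.11;
* `size_of_cut_le` — the size and the degree term of a cut `J` (`deg J ≤ t deg 𝔓 dE`,
  `h(J) ≤ t(h(𝔓) dE + h(E) deg 𝔓 + c deg 𝔓 dE)`, `1 ≤ t ≤ 5ξ(N)`, `c ≤ m(k+3)`):
  `size_N(J) ≤ 5ξ(N)δ(N)(2 + m(k+3)) size_N(𝔓)`, `m³ deg J ≤ 5m³ξ(N)δ(N) deg 𝔓`.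

## References

* [Philippon1986Criteres] P. Philippon, Publ. Math. IHÉS 64 (1986), §3, pp. 44–45.
* [NesterenkoPhilippon2001] LNM 1752 (2001), Ch. 3 Prop. 4.11, Cor. 4.12 (pp. 40–41).
-/

noncomputable section

open MvPolynomial Real
open Literature.NumberTheory.Transcendental.Nesterenko

namespace Literature.NumberTheory.Transcendental

namespace PhilipponMain

namespace Setup

variable (𝒮 : Setup)

/-! ### The size under `(i)_N` -/

/-- Under `(i)_N`: `size_N(𝔓) ≤ (B_r + D₀) τ(N) δ(N)^{r₀−r}`. [cite: Philippon1986Criteres, §3 p. 44] -/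
theorem size_le_of_bounds {r r' : ℕ} (N : ℕ) {𝔓 : Ideal (Rx 𝒮.m)}
    (hdeg : (ideg 𝔓 r' : ℝ) ≤ 𝒮.D₀ * 𝒮.δ N ^ (𝒮.r₀ - r))
    (hh : iheight 𝔓 r' ≤ 𝒮.B r * 𝒮.τ N * 𝒮.δ N ^ (𝒮.r₀ - r) / 𝒮.δ N) :
    𝒮.size N 𝔓 r' ≤ (𝒮.B r + 𝒮.D₀) * 𝒮.τ N * 𝒮.δ N ^ (𝒮.r₀ - r) := by
  unfold size
  have hδ := 𝒮.δ_pos N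
  have hτ := 𝒮.τ_pos N
  have h1 : 𝒮.δ N * iheight 𝔓 r' ≤ 𝒮.B r * 𝒮.τ N * 𝒮.δ N ^ (𝒮.r₀ - r) := by
    rw [mul_comm]; exact (le_div_iff₀ hδ).mp hh
  have h2 : 𝒮.τ N * ideg 𝔓 r' ≤ 𝒮.D₀ * 𝒮.τ N * 𝒮.δ N ^ (𝒮.r₀ - r) := by
    have := mul_le_mul_of_nonneg_left hdeg hτ.le
    linarith
  linarith

/-- `δ(N)^{r₀−r} ≤ δ(N)^k` for `1 ≤ r` (as `r₀ ≤ k + 1`, `δ ≥ 1`). [folklore] -/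
theorem pow_r₀_sub_le_pow_k {r : ℕ} (hr1 : 1 ≤ r) (N : ℕ) :
    𝒮.δ N ^ (𝒮.r₀ - r) ≤ 𝒮.δ N ^ 𝒮.k :=
  pow_le_pow_right₀ (𝒮.one_le_δ N) (by have := 𝒮.r₀_le; omega)

/-- Hence `(1 + 11m²) size_N(𝔓) ≤ S(N)/2` as soon as `C ≥ 2(1 + 11m²)(B_r + D₀)`
(`S ≥ C τ δ^k`). [cite: Philippon1986Criteres, §3 p. 44 ("si C est assez grand")] -/
theorem cS_mul_size_le_half_S {r r' : ℕ} (hr1 : 1 ≤ r) (N : ℕ) {𝔓 : Ideal (Rx 𝒮.m)}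
    (hdeg : (ideg 𝔓 r' : ℝ) ≤ 𝒮.D₀ * 𝒮.δ N ^ (𝒮.r₀ - r))
    (hh : iheight 𝔓 r' ≤ 𝒮.B r * 𝒮.τ N * 𝒮.δ N ^ (𝒮.r₀ - r) / 𝒮.δ N)
    (hC : 2 * (1 + 11 * (𝒮.m : ℝ) ^ 2) * (𝒮.B r + 𝒮.D₀) ≤ 𝒮.C) :
    (1 + 11 * (𝒮.m : ℝ) ^ 2) * 𝒮.size N 𝔓 r' ≤ 𝒮.S N / 2 := by
  have hsize := 𝒮.size_le_of_bounds N hdeg hh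
  have hτ := 𝒮.τ_pos N
  have hBD : 0 ≤ 𝒮.B r + 𝒮.D₀ := add_nonneg (𝒮.B_nonneg r) (Nat.cast_nonneg _)
  have hpow := 𝒮.pow_r₀_sub_le_pow_k hr1 N
  have hS := 𝒮.S_ge N
  have h1 : 𝒮.size N 𝔓 r' ≤ (𝒮.B r + 𝒮.D₀) * 𝒮.τ N * 𝒮.δ N ^ 𝒮.k :=
    hsize.trans (mul_le_mul_of_nonneg_left hpow (mul_nonneg hBD hτ.le))
  have hm : (0 : ℝ) ≤ 1 + 11 * (𝒮.m : ℝ) ^ 2 := by positivity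
  have hτδ : 0 ≤ 𝒮.τ N * 𝒮.δ N ^ 𝒮.k := mul_nonneg hτ.le (pow_nonneg (𝒮.δ_pos N).le _)
  calc (1 + 11 * (𝒮.m : ℝ) ^ 2) * 𝒮.size N 𝔓 r'
      ≤ (1 + 11 * (𝒮.m : ℝ) ^ 2) * ((𝒮.B r + 𝒮.D₀) * 𝒮.τ N * 𝒮.δ N ^ 𝒮.k) :=
        mul_le_mul_of_nonneg_left h1 hm
    _ = (2 * (1 + 11 * (𝒮.m : ℝ) ^ 2) * (𝒮.B r + 𝒮.D₀)) * (𝒮.τ N * 𝒮.δ N ^ 𝒮.k) / 2 := by ring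
    _ ≤ 𝒮.C * (𝒮.τ N * 𝒮.δ N ^ 𝒮.k) / 2 := by
        have := mul_le_mul_of_nonneg_right hC hτδ; linarith
    _ = 𝒮.C * 𝒮.τ N * 𝒮.δ N ^ 𝒮.k / 2 := by ring
    _ ≤ 𝒮.S N / 2 := by linarith

/-! ### The positive terms of Prop. 4.11 3) / Cor. 4.12 3) -/

/-- For a generator `E` of level `M ≤ N` (`deg E = dE ≤ δ(M)`, `h(E) ≤ σ(M)`):
`h(E) deg 𝔓 + h(𝔓) dE + 11 m² deg 𝔓 dE ≤ (1 + 11m²) size_N(𝔓)`.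
[cite: NesterenkoPhilippon2001, Ch. 3 Prop. 4.11 3) (p. 41)] -/
theorem bezout_exponent_le {M N : ℕ} (hMN : M ≤ N) (hM : 𝒮.N₀ ≤ M) (i : Fin (𝒮.M M))
    (𝔓 : Ideal (Rx 𝒮.m)) (r' : ℕ) :
    height (𝒮.E M i) * ideg 𝔓 r' + iheight 𝔓 r' * (𝒮.d M i) +
        11 * (𝒮.m : ℝ) ^ 2 * ideg 𝔓 r' * (𝒮.d M i) ≤
      (1 + 11 * (𝒮.m : ℝ) ^ 2) * 𝒮.size N 𝔓 r' := by
  have hd : (𝒮.d M i : ℝ) ≤ 𝒮.δ N := (𝒮.d_le M hM i).trans (𝒮.mono_δ hMN)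
  have hhE : height (𝒮.E M i) ≤ 𝒮.τ N :=
    ((𝒮.height_le M hM i).trans (𝒮.mono_σ hMN)).trans (𝒮.σ_le_τ N)
  have hdeg0 : (0 : ℝ) ≤ ideg 𝔓 r' := Nat.cast_nonneg _
  have hh0 : 0 ≤ iheight 𝔓 r' := height_nonneg _
  have hd0 : (0 : ℝ) ≤ 𝒮.d M i := Nat.cast_nonneg _
  have hδτ := 𝒮.δ_le_τ N
  have e1 : height (𝒮.E M i) * ideg 𝔓 r' ≤ 𝒮.τ N * ideg 𝔓 r' :=
    mul_le_mul_of_nonneg_right hhE hdeg0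
  have e2 : iheight 𝔓 r' * (𝒮.d M i) ≤ 𝒮.δ N * iheight 𝔓 r' := by
    rw [mul_comm]; exact mul_le_mul_of_nonneg_right hd hh0
  have e3 : 11 * (𝒮.m : ℝ) ^ 2 * ideg 𝔓 r' * (𝒮.d M i) ≤
      11 * (𝒮.m : ℝ) ^ 2 * (𝒮.τ N * ideg 𝔓 r') := by
    have : (ideg 𝔓 r' : ℝ) * 𝒮.d M i ≤ 𝒮.τ N * ideg 𝔓 r' := by
      rw [mul_comm (𝒮.τ N)]
      exact mul_le_mul_of_nonneg_left (hd.trans hδτ) hdeg0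
    nlinarith [sq_nonneg (𝒮.m : ℝ)]
  have hs := 𝒮.τ_mul_ideg_le_size N 𝔓 r'
  have hsize : 𝒮.size N 𝔓 r' = 𝒮.δ N * iheight 𝔓 r' + 𝒮.τ N * ideg 𝔓 r' := rfl
  nlinarith [sq_nonneg (𝒮.m : ℝ), e1, e2, e3, hs]

/-- Likewise for Cor. 4.12: `h(𝔓) dE + h(E) deg 𝔓 + 12 m² dE deg 𝔓 ≤ (1 + 12m²) size_N(𝔓)`.
[cite: NesterenkoPhilippon2001, Ch. 3 Cor. 4.12 3) (p. 41)] -/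
theorem bezout_exponent_le' {M N : ℕ} (hMN : M ≤ N) (hM : 𝒮.N₀ ≤ M) (i : Fin (𝒮.M M))
    (𝔓 : Ideal (Rx 𝒮.m)) (r' : ℕ) :
    iheight 𝔓 r' * (𝒮.d M i) + height (𝒮.E M i) * ideg 𝔓 r' +
        12 * (𝒮.m : ℝ) ^ 2 * (𝒮.d M i) * ideg 𝔓 r' ≤
      (1 + 12 * (𝒮.m : ℝ) ^ 2) * 𝒮.size N 𝔓 r' := by
  have hd : (𝒮.d M i : ℝ) ≤ 𝒮.δ N := (𝒮.d_le M hM i).trans (𝒮.mono_δ hMN)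
  have hhE : height (𝒮.E M i) ≤ 𝒮.τ N :=
    ((𝒮.height_le M hM i).trans (𝒮.mono_σ hMN)).trans (𝒮.σ_le_τ N)
  have hdeg0 : (0 : ℝ) ≤ ideg 𝔓 r' := Nat.cast_nonneg _
  have hh0 : 0 ≤ iheight 𝔓 r' := height_nonneg _
  have hd0 : (0 : ℝ) ≤ 𝒮.d M i := Nat.cast_nonneg _
  have hδτ := 𝒮.δ_le_τ N
  have e1 : height (𝒮.E M i) * ideg 𝔓 r' ≤ 𝒮.τ N * ideg 𝔓 r' :=
    mul_le_mul_of_nonneg_right hhE hdeg0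
  have e2 : iheight 𝔓 r' * (𝒮.d M i) ≤ 𝒮.δ N * iheight 𝔓 r' := by
    rw [mul_comm]; exact mul_le_mul_of_nonneg_right hd hh0
  have e3 : 12 * (𝒮.m : ℝ) ^ 2 * (𝒮.d M i) * ideg 𝔓 r' ≤
      12 * (𝒮.m : ℝ) ^ 2 * (𝒮.τ N * ideg 𝔓 r') := by
    have : (𝒮.d M i : ℝ) * ideg 𝔓 r' ≤ 𝒮.τ N * ideg 𝔓 r' :=
      mul_le_mul_of_nonneg_right (hd.trans hδτ) hdeg0
    nlinarith [sq_nonneg (𝒮.m : ℝ)]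
  have hs := 𝒮.τ_mul_ideg_le_size N 𝔓 r'
  have hsize : 𝒮.size N 𝔓 r' = 𝒮.δ N * iheight 𝔓 r' + 𝒮.τ N * ideg 𝔓 r' := rfl
  nlinarith [sq_nonneg (𝒮.m : ℝ), e1, e2, e3, hs]

/-! ### The integer `η = ⌈4 ξ(M)⌉` -/

/-- `η = ⌈4ξ(M)⌉ ≥ 4ξ(M) ≥ 4 > 0`. [folklore] -/
theorem le_eta (M : ℕ) : 4 * 𝒮.ξ M ≤ (⌈4 * 𝒮.ξ M⌉₊ : ℝ) := Nat.le_ceil _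

/-- `η > 0`. [folklore] -/
theorem eta_pos (M : ℕ) : 0 < ⌈4 * 𝒮.ξ M⌉₊ := by
  have h := 𝒮.le_eta M
  have h1 := 𝒮.one_le_ξ M
  have : (0 : ℝ) < ⌈4 * 𝒮.ξ M⌉₊ := by linarith
  exact_mod_cast this

/-- `η ≤ 4ξ(M) + 1 ≤ 5ξ(N)` for `M ≤ N` (`ξ ≥ 1` non-decreasing). [folklore] -/
theorem eta_le {M N : ℕ} (hMN : M ≤ N) : (⌈4 * 𝒮.ξ M⌉₊ : ℝ) ≤ 5 * 𝒮.ξ N := by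
  have h1 : (⌈4 * 𝒮.ξ M⌉₊ : ℝ) < 4 * 𝒮.ξ M + 1 := Nat.ceil_lt_add_one (by
    linarith [𝒮.one_le_ξ M])
  have h2 := 𝒮.mono_ξ hMN
  have h3 := 𝒮.one_le_ξ N
  linarith

/-! ### The hypothesis of Cor. 4.12 in the case `M < N` -/

/-- **`‖E‖^η ≤ ρ²`** (the hypothesis `−η log ‖P‖_ω̄ ≥ 2 log(1/ρ)` of Cor. 4.12) for a generator
`E = E M i` with `‖E‖_ω̄ ≤ e^{−S(M)}`, when `κ e^{−R(M+1)} ≤ ρ`, `η = ⌈4ξ(M)⌉`, and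
`log(4Θ²) ≤ C`: indeed `η S(M) ≥ 4ξ(M) S(M) ≥ 2(S(M)ξ(M) + S(M)) ≥ 2(R(M+1) + log(1/κ))`.
[cite: Philippon1986Criteres, §3 p. 45 (second case, η = S(M)/2R(M+1))] -/
theorem normAt_pow_eta_le_sq {M : ℕ} (hM : 𝒮.N₀ ≤ M) (i : Fin (𝒮.M M)) {ρ : ℝ}
    (hρ : 𝒮.κ * exp (-𝒮.R (M + 1)) ≤ ρ) (hC : log (4 * 𝒮.Θ ^ 2) ≤ 𝒮.C) :
    normAt 𝒮.ω (𝒮.E M i) ^ ⌈4 * 𝒮.ξ M⌉₊ ≤ ρ ^ 2 := by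
  have hval : normAt 𝒮.ω (𝒮.E M i) ≤ exp (-𝒮.S M) := 𝒮.normAt_le M hM i
  have hn0 : 0 ≤ normAt 𝒮.ω (𝒮.E M i) := normAt_nonneg _ _
  have hκ := 𝒮.κ_pos
  have hS := 𝒮.S_pos M
  -- `‖E‖^η ≤ exp(−η S(M))`
  have h1 : normAt 𝒮.ω (𝒮.E M i) ^ ⌈4 * 𝒮.ξ M⌉₊ ≤ exp (-𝒮.S M) ^ ⌈4 * 𝒮.ξ M⌉₊ :=
    pow_le_pow_left₀ hn0 hval _
  rw [← exp_nat_mul] at h1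
  -- `exp(−η S(M)) ≤ (κ e^{−R(M+1)})² ≤ ρ²`
  have hρ0 : 0 ≤ 𝒮.κ * exp (-𝒮.R (M + 1)) := by positivity
  refine h1.trans (le_trans ?_ (pow_le_pow_left₀ hρ0 hρ 2))
  rw [mul_pow, ← exp_nat_mul, show ((2 : ℕ) : ℝ) * -𝒮.R (M + 1) = -(2 * 𝒮.R (M + 1)) by
    push_cast; ring]
  -- `κ² = exp(−2 log(4Θ²))`... : `κ = exp(−log(4Θ²))`
  have hκexp : 𝒮.κ = exp (-log (4 * 𝒮.Θ ^ 2)) := by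
    rw [exp_neg, exp_log (by have := 𝒮.Θ_pos; positivity)]
    unfold κ; rw [one_div]
  rw [hκexp, ← exp_nat_mul, ← exp_add, exp_le_exp]
  push_cast
  -- goal: `η · (−S M) ≤ 2·(−log(4Θ²)) + −(2 R(M+1))`
  have hR : 𝒮.R (M + 1) ≤ 𝒮.S M * 𝒮.ξ M := 𝒮.R_succ_le M
  have hlog : log (4 * 𝒮.Θ ^ 2) ≤ 𝒮.S M := hC.trans (𝒮.C_le_S M)
  have hη : 4 * 𝒮.ξ M ≤ (⌈4 * 𝒮.ξ M⌉₊ : ℝ) := 𝒮.le_eta M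
  have hξ := 𝒮.one_le_ξ M
  have hlog0 : 0 ≤ log (4 * 𝒮.Θ ^ 2) := log_nonneg (by nlinarith [𝒮.one_le_Θ])
  nlinarith [mul_le_mul_of_nonneg_right hη hS.le, mul_nonneg hS.le (sub_nonneg.mpr hξ)]

/-- And `‖E‖ ≤ e^{−2 m deg E}` (the other hypothesis of Cor. 4.12) since
`S(M) ≥ C δ(M) ≥ 2m δ(M) ≥ 2m dE` for `C ≥ 2m`. [cite: NesterenkoPhilippon2001, Ch. 3 Cor. 4.12 (p. 41)] -/
theorem normAt_le_exp_deg {M : ℕ} (hM : 𝒮.N₀ ≤ M) (i : Fin (𝒮.M M)) (hC : 2 * (𝒮.m : ℝ) ≤ 𝒮.C) :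
    normAt 𝒮.ω (𝒮.E M i) ≤ exp (-(2 * (𝒮.m : ℝ) * (𝒮.d M i))) := by
  refine (𝒮.normAt_le M hM i).trans ?_
  rw [exp_le_exp, neg_le_neg_iff]
  have hd : (𝒮.d M i : ℝ) ≤ 𝒮.δ M := 𝒮.d_le M hM i
  have hS : 𝒮.C * 𝒮.τ M ≤ 𝒮.S M := 𝒮.C_mul_τ_le_S M
  have hδτ : 𝒮.δ M ≤ 𝒮.τ M := 𝒮.δ_le_τ M
  have hm : (0 : ℝ) ≤ 𝒮.m := Nat.cast_nonneg _
  have hC0 := 𝒮.C_pos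
  calc 2 * (𝒮.m : ℝ) * 𝒮.d M i ≤ 2 * (𝒮.m : ℝ) * 𝒮.τ M := by
        exact mul_le_mul_of_nonneg_left (hd.trans hδτ) (by positivity)
    _ ≤ 𝒮.C * 𝒮.τ M := mul_le_mul_of_nonneg_right hC (𝒮.τ_pos M).le
    _ ≤ 𝒮.S M := hS

/-- **`deg E ≥ 1` for a non-zero generator** (the hypothesis `1 ≤ d` of Corollary 4.12 and
Proposition 4.11): a non-zero constant `E = c` has `‖E‖_ω̄ = |c| / |c| = 1`, contradicting
`‖E‖_ω̄ ≤ e^{−S(M)} < 1`. [cite: NesterenkoPhilippon2001, Ch. 3 Cor. 4.12 (p. 41)] -/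
theorem one_le_d {M : ℕ} (hM : 𝒮.N₀ ≤ M) (i : Fin (𝒮.M M)) (hE0 : 𝒮.E M i ≠ 0) :
    1 ≤ 𝒮.d M i := by
  classical
  by_contra hd
  have hd0 : 𝒮.d M i = 0 := by omega
  have hhom := 𝒮.isHomogeneous_E M i
  rw [hd0] at hhom
  have htot : (𝒮.E M i).totalDegree = 0 := Nat.le_zero.mp hhom.totalDegree_le
  rw [totalDegree_eq_zero_iff_eq_C] at htot
  set c : ℚ := (𝒮.E M i).coeff 0 with hcdef
  have hc : c ≠ 0 := fun h => hE0 (by rw [htot, h, MvPolynomial.C_0])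
  have hmax : maxNorm (MvPolynomial.C c : Rx 𝒮.m) = ‖c‖ := by
    rw [maxNorm, C_apply, support_monomial, if_neg hc, Finset.sup_singleton, coeff_monomial,
      if_pos rfl, coe_nnnorm]
  have hone : normAt (Fin.cons 1 𝒮.θ : Fin (𝒮.m + 1) → ℂ) (𝒮.E M i) = 1 := by
    rw [htot, normAt, aeval_C, totalDegree_C, pow_zero, mul_one, hmax, eq_ratCast,
      Complex.norm_ratCast, ← Rat.norm_cast_real, Real.norm_eq_abs]
    exact div_self (abs_ne_zero.mpr (Rat.cast_ne_zero.mpr hc))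
  have hle := 𝒮.normAt_le M hM i
  rw [hone] at hle
  have hlt : exp (-𝒮.S M) < 1 := by
    rw [exp_lt_one_iff, neg_lt_zero]
    exact 𝒮.S_pos M
  linarith

/-! ### The size of a cut -/

/-- **Size of a cut.** If `deg J ≤ t · deg 𝔓 · dE` and
`h(J) ≤ t (h(𝔓) dE + h(E) deg 𝔓 + c · deg 𝔓 · dE)` for a generator `E = E M i` of level `M ≤ N`
(`dE ≤ δ(N)`, `h(E) ≤ σ(N) ≤ τ(N)`), with `1 ≤ t ≤ 5ξ(N)` and `c ≤ m(k+3)` (Prop. 4.11: `t = 1`,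
`c = m(r+1)`; Cor. 4.12: `t = η`, `c = m(r+2)`), then `size_N(J) ≤ 5 ξ(N) δ(N) (2 + m(k+3)) size_N(𝔓)`
and `m³ deg J ≤ 5 m³ ξ(N) δ(N) deg 𝔓`. [cite: Philippon1986Criteres, §3 pp. 44–45]
[cite: NesterenkoPhilippon2001, Ch. 3 Prop. 4.11 1)–2), Cor. 4.12 1)–2) (pp. 40–41)] -/
theorem size_of_cut_le {r r' : ℕ} {N M : ℕ} (hMN : M ≤ N) (hM : 𝒮.N₀ ≤ M) (i : Fin (𝒮.M M))
    {𝔓 J : Ideal (Rx 𝒮.m)} {t c : ℝ} (ht1 : 1 ≤ t) (ht : t ≤ 5 * 𝒮.ξ N)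
    (hc : c ≤ 𝒮.m * (𝒮.k + 3))
    (hJdeg : (ideg J r' : ℝ) ≤ t * (ideg 𝔓 r * 𝒮.d M i))
    (hJh : iheight J r' ≤
      t * (iheight 𝔓 r * 𝒮.d M i + height (𝒮.E M i) * ideg 𝔓 r + c * (ideg 𝔓 r * 𝒮.d M i))) :
    𝒮.size N J r' ≤ 5 * 𝒮.ξ N * 𝒮.δ N * (2 + 𝒮.m * (𝒮.k + 3)) * 𝒮.size N 𝔓 r ∧
      (𝒮.m : ℝ) ^ 3 * ideg J r' ≤ 5 * (𝒮.m : ℝ) ^ 3 * 𝒮.ξ N * 𝒮.δ N * ideg 𝔓 r := by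
  set s : ℝ := 𝒮.size N 𝔓 r with hsdef
  have hd : (𝒮.d M i : ℝ) ≤ 𝒮.δ N := (𝒮.d_le M hM i).trans (𝒮.mono_δ hMN)
  have hd0 : (0 : ℝ) ≤ 𝒮.d M i := Nat.cast_nonneg _
  have hhE : height (𝒮.E M i) ≤ 𝒮.τ N :=
    ((𝒮.height_le M hM i).trans (𝒮.mono_σ hMN)).trans (𝒮.σ_le_τ N)
  have hdeg0 : (0 : ℝ) ≤ ideg 𝔓 r := Nat.cast_nonneg _
  have hh0 : 0 ≤ iheight 𝔓 r := height_nonneg _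
  have hm0 : (0 : ℝ) ≤ 𝒮.m := Nat.cast_nonneg _
  have hδ := 𝒮.δ_pos N
  have hτ := 𝒮.τ_pos N
  have hξ0 : 0 ≤ 5 * 𝒮.ξ N := by linarith [𝒮.one_le_ξ N]
  have ht0 : 0 ≤ t := by linarith
  have hs_ge : 𝒮.τ N * ideg 𝔓 r ≤ s := 𝒮.τ_mul_ideg_le_size N 𝔓 r
  have hδh : 𝒮.δ N * iheight 𝔓 r ≤ s := 𝒮.δ_mul_iheight_le_size N 𝔓 r
  have hs0 : 0 ≤ s := 𝒮.size_nonneg N 𝔓 r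
  -- products
  have p1 : iheight 𝔓 r * (𝒮.d M i : ℝ) ≤ iheight 𝔓 r * 𝒮.δ N := mul_le_mul_of_nonneg_left hd hh0
  have p2 : height (𝒮.E M i) * (ideg 𝔓 r : ℝ) ≤ 𝒮.τ N * ideg 𝔓 r :=
    mul_le_mul_of_nonneg_right hhE hdeg0
  have p3 : (ideg 𝔓 r : ℝ) * 𝒮.d M i ≤ ideg 𝔓 r * 𝒮.τ N :=
    mul_le_mul_of_nonneg_left (hd.trans (𝒮.δ_le_τ N)) hdeg0
  have p30 : 0 ≤ (ideg 𝔓 r : ℝ) * 𝒮.d M i := mul_nonneg hdeg0 hd0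
  have p4 : c * ((ideg 𝔓 r : ℝ) * 𝒮.d M i) ≤ 𝒮.m * (𝒮.k + 3) * (ideg 𝔓 r * 𝒮.τ N) :=
    mul_le_mul hc p3 p30 (by positivity)
  have p5 : (ideg 𝔓 r : ℝ) * 𝒮.d M i ≤ ideg 𝔓 r * 𝒮.δ N := mul_le_mul_of_nonneg_left hd hdeg0
  -- `h(J) ≤ t (1 + m(k+3)) s`, `τ deg J ≤ t δ s`
  have hin : iheight 𝔓 r * (𝒮.d M i : ℝ) + height (𝒮.E M i) * ideg 𝔓 r +
      c * (ideg 𝔓 r * 𝒮.d M i) ≤ (1 + 𝒮.m * (𝒮.k + 3)) * s := by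
    have e1 : iheight 𝔓 r * 𝒮.δ N = 𝒮.δ N * iheight 𝔓 r := mul_comm _ _
    have e2 : (ideg 𝔓 r : ℝ) * 𝒮.τ N = 𝒮.τ N * ideg 𝔓 r := mul_comm _ _
    rw [e1] at p1
    rw [e2] at p4
    have e3 : (1 + 𝒮.m * (𝒮.k + 3)) * s = s + 𝒮.m * (𝒮.k + 3) * s := by ring
    rw [e3]
    have e4 : 𝒮.m * (𝒮.k + 3) * (𝒮.τ N * (ideg 𝔓 r : ℝ)) ≤ 𝒮.m * (𝒮.k + 3) * s :=
      mul_le_mul_of_nonneg_left hs_ge (by positivity)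
    have hsd : s = 𝒮.δ N * iheight 𝔓 r + 𝒮.τ N * ideg 𝔓 r := rfl
    linarith
  have hhJ : iheight J r' ≤ t * ((1 + 𝒮.m * (𝒮.k + 3)) * s) :=
    hJh.trans (mul_le_mul_of_nonneg_left hin ht0)
  have hdegJ : (ideg J r' : ℝ) ≤ t * (ideg 𝔓 r * 𝒮.δ N) :=
    hJdeg.trans (mul_le_mul_of_nonneg_left p5 ht0)
  constructor
  · unfold size
    have e1 : 𝒮.δ N * iheight J r' ≤ 𝒮.δ N * (t * ((1 + 𝒮.m * (𝒮.k + 3)) * s)) :=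
      mul_le_mul_of_nonneg_left hhJ hδ.le
    have e2 : 𝒮.τ N * ideg J r' ≤ t * (𝒮.δ N * s) := by
      calc 𝒮.τ N * ideg J r' ≤ 𝒮.τ N * (t * (ideg 𝔓 r * 𝒮.δ N)) :=
            mul_le_mul_of_nonneg_left hdegJ hτ.le
        _ = t * (𝒮.δ N * (𝒮.τ N * ideg 𝔓 r)) := by ring
        _ ≤ t * (𝒮.δ N * s) :=
            mul_le_mul_of_nonneg_left (mul_le_mul_of_nonneg_left hs_ge hδ.le) ht0
    have e3 : 𝒮.δ N * (t * ((1 + 𝒮.m * (𝒮.k + 3)) * s)) + t * (𝒮.δ N * s) =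
        t * (𝒮.δ N * (2 + 𝒮.m * (𝒮.k + 3)) * s) := by ring
    have e4 : t * (𝒮.δ N * (2 + 𝒮.m * (𝒮.k + 3)) * s) ≤
        (5 * 𝒮.ξ N) * (𝒮.δ N * (2 + 𝒮.m * (𝒮.k + 3)) * s) :=
      mul_le_mul_of_nonneg_right ht (by positivity)
    have e5 : (5 * 𝒮.ξ N) * (𝒮.δ N * (2 + 𝒮.m * (𝒮.k + 3)) * s) =
        5 * 𝒮.ξ N * 𝒮.δ N * (2 + 𝒮.m * (𝒮.k + 3)) * s := by ring
    linarith
  · have e1 : (𝒮.m : ℝ) ^ 3 * ideg J r' ≤ (𝒮.m : ℝ) ^ 3 * (t * (ideg 𝔓 r * 𝒮.δ N)) :=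
      mul_le_mul_of_nonneg_left hdegJ (by positivity)
    have e2 : (𝒮.m : ℝ) ^ 3 * (t * (ideg 𝔓 r * 𝒮.δ N)) ≤ (𝒮.m : ℝ) ^ 3 * ((5 * 𝒮.ξ N) * (ideg 𝔓 r * 𝒮.δ N)) :=
      mul_le_mul_of_nonneg_left (mul_le_mul_of_nonneg_right ht (by positivity)) (by positivity)
    have e3 : (𝒮.m : ℝ) ^ 3 * ((5 * 𝒮.ξ N) * (ideg 𝔓 r * 𝒮.δ N)) =
        5 * (𝒮.m : ℝ) ^ 3 * 𝒮.ξ N * 𝒮.δ N * ideg 𝔓 r := by ring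
    linarith

end Setup

end PhilipponMain

end Literature.NumberTheory.Transcendental

end
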